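import Mathlib
import Summits.MatrixMultiplication.Statement
import Summits.MatrixMultiplication.MatrixMultiplication.Theorems.GraphEquationsAffineQuadric

/-!
# Leading-order degeneracy of nowhere-reduced affine systems (`GraphEquations`, M41)

Decomp-mm node «GraphEquations» (lens 5 «finite range + asymptotic regime + bridge», g39); attacked
leaf `MultiplicityReduction` (stmt-MatrixMultiplication-27806).  Target of the node, VERBATIM:
`_root_.MatrixMultiplication`.  Route-neutral (`closes` unchanged); imports no `Theses/` file.
Companion of `GraphEquationsAffineQuadric` (M40: the model `AffTest` / `AffSystem`, `Correct`,
`IsKer`, `ReducedAt`, `NowhereReduced`, `AffineQuadricRigidity`).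

* **`NowhereReduced.exists_common_orth_quadPart` (leading-order degeneracy; memo D2 of NODE-g37,
  now a theorem).**  If an affine system is reduced NOWHERE then for every `c ∈ ℂ^{n×n}` the vectors
  `M_g c` (quadratic parts applied to `c`) have a common non-zero orthogonal vector — they do NOT
  span.  Proof: along the two-parameter family `(A,B) = (s·c, t·1)` the gradients are
  `κ_g + s·L_A c + t·L_B 1 + st·M_g c` (`AffTest.jac_smul_smul_idFun`); if the `M_g c` spanned, a
  left inverse `Y` of their matrix (coordinate duality `exists_dotProduct_eq_zero_of_span_ne_top` +
  `Submodule.mem_span_range_iff_exists_fun`) gives `Y·J(s,t) = s·(Y A + t·1) + (Y K + t·Y B)`,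
  whose determinant is non-zero for a suitable `t` and then a suitable `s`
  (`exists_det_smul_add_ne_zero`: the top coefficient of `det (X·P + Q)` is `det P`,
  `Polynomial.coeff_det_X_add_C_card`, and `ℂ` is infinite); but then every kernel direction at
  `(s·c, t·1)` is `0`, i.e. the system IS reduced there.
  Reading: a counterexample to C3ₙ / AQRₙ must have quadratic parts `{M_g}` such that NO `c` makes
  `δ ↦ (⟨M_g c, δ⟩)_g` injective — a closed, testable condition on the span `⟨M_g⟩ ⊂ End ℂ^{n×n}`
  (it excludes every span containing an invertible operator, in particular the identity).
* `NowhereReduced.exists_common_left_ker_of_rank_one` — in the RANK-ONE sub-case with a common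
  right factor, `M_g = x_g ⊗ y`, degeneracy at `c = e_q` (`y_q ≠ 0`) produces a common non-zero
  LEFT KERNEL vector `w` of all `M_g`; `GraphEquationsAffineQuadric` then shows `w` is never a
  kernel direction of a correct system (honest status of the sub-case: constrained, not closed).

Tags (cell census): WEAKER than the summit (fixed-`n` linear algebra over `ℂ`; no cost, no
exponent), PROVED, unconditional.  No `sorry`.
-/

-- dupNamespace: forced by the nested Summit.MatrixMultiplication.MatrixMultiplication layout (D-0017)
set_option linter.dupNamespace false

noncomputable section

namespace Summit.MatrixMultiplication.MatrixMultiplication.Theorems.GraphEquations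

open Matrix Polynomial

variable {n : ℕ}

namespace AffSystem

variable {S : AffSystem n}

/-! ## Leading-order degeneracy of nowhere-reduced systems -/

/-- Coordinate duality: a family of vectors that does not span `ℂ^{n×n}` has a common non-zero
orthogonal vector for the dot product. -/
theorem exists_dotProduct_eq_zero_of_span_ne_top {ι : Type*} (v : ι → Vec n)
    (h : Submodule.span ℂ (Set.range v) ≠ ⊤) : ∃ w : Vec n, w ≠ 0 ∧ ∀ i, v i ⬝ᵥ w = 0 := by
  classical
  obtain ⟨f, hf, hle⟩ := Submodule.exists_le_ker_of_lt_top _ (lt_top_iff_ne_top.mpr h)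
  let w : Vec n := fun q => f fun j => if q = j then 1 else 0
  have hfw : ∀ x : Vec n, f x = x ⬝ᵥ w := fun x => by
    rw [LinearMap.pi_apply_eq_sum_univ f x]
    simp only [dotProduct, smul_eq_mul, w]
  refine ⟨w, fun hw0 => hf (LinearMap.ext fun x => ?_), fun i => ?_⟩
  · rw [hfw, hw0, dotProduct_zero, LinearMap.zero_apply]
  · rw [← hfw]
    exact hle (Submodule.subset_span ⟨i, rfl⟩)

/-- If the only common orthogonal vector is `0`, the family spans. -/
theorem span_eq_top_of_forall_dotProduct {ι : Type*} (v : ι → Vec n)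
    (h : ∀ w : Vec n, (∀ i, v i ⬝ᵥ w = 0) → w = 0) : Submodule.span ℂ (Set.range v) = ⊤ := by
  by_contra hne
  obtain ⟨w, hw, horth⟩ := exists_dotProduct_eq_zero_of_span_ne_top v hne
  exact hw (h w horth)

/-- Genericity of invertibility on a pencil: if `det P ≠ 0` then `det (s·P + Q) ≠ 0` for some `s`
(the degree-`N` coefficient of `det (X·P + Q)` is `det P`, and `ℂ` is infinite). -/
theorem exists_det_smul_add_ne_zero {m : Type*} [Fintype m] [DecidableEq m] (P Q : Matrix m m ℂ)
    (hP : P.det ≠ 0) : ∃ s : ℂ, (s • P + Q).det ≠ 0 := by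
  let p : ℂ[X] := ((X : ℂ[X]) • P.map C + Q.map C).det
  have hcoeff : p.coeff (Fintype.card m) = P.det := Polynomial.coeff_det_X_add_C_card P Q
  have hp : p ≠ 0 := fun h => hP (by rw [← hcoeff, h, Polynomial.coeff_zero])
  obtain ⟨s, hs⟩ := Infinite.exists_notMem_finset p.roots.toFinset
  refine ⟨s, fun hdet => hs ?_⟩
  have heval : p.eval s = (s • P + Q).det := by
    show Polynomial.evalRingHom s p = _
    rw [RingHom.map_det, RingHom.mapMatrix_apply]
    congr 1
    ext i j
    simp only [Matrix.map_apply, Matrix.add_apply, Matrix.smul_apply, smul_eq_mul,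
      Polynomial.coe_evalRingHom, Polynomial.eval_add, Polynomial.eval_mul, Polynomial.eval_X,
      Polynomial.eval_C, mul_comm s]
  rw [Multiset.mem_toFinset, Polynomial.mem_roots hp, Polynomial.IsRoot.def, heval, hdet]

/-- **Leading-order degeneracy (memo D2).**  If `S` is reduced NOWHERE then for every `c` the
vectors `M_g c` have a common non-zero orthogonal vector, i.e. they do not span `ℂ^{n×n}`.
Proof: along `(A,B) = (s·c, t·1)` the gradients are `κ_g + s·L_A c + t·L_B 1 + st·M_g c`; if the
`M_g c` spanned, a left inverse `Y` of their matrix gives `det (Y·J(s,t)) ≠ 0` for suitable `t, s`,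
and then `S` is reduced at `(s·c, t·1)`. -/
theorem NowhereReduced.exists_common_orth_quadPart (hNR : S.NowhereReduced) (c : Vec n) :
    ∃ w : Vec n, w ≠ 0 ∧ ∀ i, ((S.test i).M *ᵥ c) ⬝ᵥ w = 0 := by
  by_contra hcon
  push Not at hcon
  have hspan : Submodule.span ℂ (Set.range fun i => (S.test i).M *ᵥ c) = ⊤ :=
    span_eq_top_of_forall_dotProduct _ fun w hw => by
      by_contra hw0
      obtain ⟨i, hi⟩ := hcon w hw0
      exact hi (hw i)
  have hrow : ∀ q : Fin n × Fin n, ∃ y : Fin S.m → ℂ,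
      ∑ i, y i • ((S.test i).M *ᵥ c) = (1 : SqMat n) q := fun q =>
    (Submodule.mem_span_range_iff_exists_fun ℂ).mp (hspan ▸ Submodule.mem_top)
  choose y hy using hrow
  -- matrices: `Y` (the left inverse) and the four row blocks of the Jacobian family
  let Y : Matrix (Fin n × Fin n) (Fin S.m) ℂ := Matrix.of y
  let Kr : Matrix (Fin S.m) (Fin n × Fin n) ℂ := Matrix.of fun i => (S.test i).κ
  let Ar : Matrix (Fin S.m) (Fin n × Fin n) ℂ := Matrix.of fun i => (S.test i).LA *ᵥ c
  let Br : Matrix (Fin S.m) (Fin n × Fin n) ℂ := Matrix.of fun i => (S.test i).LB *ᵥ idFun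
  let Mr : Matrix (Fin S.m) (Fin n × Fin n) ℂ := Matrix.of fun i => (S.test i).M *ᵥ c
  have hYM : Y * Mr = 1 := by
    ext q q'
    have h := congrFun (hy q) q'
    simpa [Y, Mr, Matrix.mul_apply, Finset.sum_apply, Pi.smul_apply] using h
  have hJ : ∀ s t : ℂ, (Matrix.of fun i => (S.test i).jac (s • c) (t • idFun)) =
      Kr + s • Ar + t • Br + (s * t) • Mr := by
    intro s t
    ext i q
    simp [Kr, Ar, Br, Mr, AffTest.jac_smul_smul_idFun, Matrix.add_apply]
  obtain ⟨t, ht⟩ := exists_det_smul_add_ne_zero (1 : SqMat n) (Y * Ar) (by simp)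
  obtain ⟨s, hs⟩ := exists_det_smul_add_ne_zero (Y * Ar + t • (1 : SqMat n))
    (Y * Kr + t • (Y * Br)) (by rwa [add_comm])
  have hP : Y * (Matrix.of fun i => (S.test i).jac (s • c) (t • idFun)) =
      s • (Y * Ar + t • (1 : SqMat n)) + (Y * Kr + t • (Y * Br)) := by
    rw [hJ]
    simp only [Matrix.mul_add, Matrix.mul_smul, hYM, mul_smul, smul_add]
    abel
  refine hNR (s • c) (t • idFun) fun δ hδ => ?_
  have h1 : (Matrix.of fun i => (S.test i).jac (s • c) (t • idFun)) *ᵥ δ = 0 :=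
    funext fun i => hδ i
  have h2 : (s • (Y * Ar + t • (1 : SqMat n)) + (Y * Kr + t • (Y * Br))) *ᵥ δ = 0 := by
    rw [← hP, ← mulVec_mulVec, h1, mulVec_zero]
  exact eq_zero_of_mulVec_eq_zero hs h2

/-- Equivalent phrasing: in a nowhere-reduced system no `c` makes `δ ↦ (⟨M_g c, δ⟩)_g` injective. -/
theorem NowhereReduced.not_forall_quadPart_orth_imp_zero (hNR : S.NowhereReduced) (c : Vec n) :
    ¬ ∀ w : Vec n, (∀ i, ((S.test i).M *ᵥ c) ⬝ᵥ w = 0) → w = 0 := by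
  obtain ⟨w, hw, horth⟩ := hNR.exists_common_orth_quadPart c
  exact fun h => hw (h w horth)

/-! ## The rank-one sub-case reduces to a common left kernel vector -/

/-- **Rank-one quadratic parts with a common right factor** `M_g = x_g ⊗ y` (`y ≠ 0`): a
nowhere-reduced system has a common non-zero LEFT KERNEL vector of all `M_g`. -/
theorem NowhereReduced.exists_common_left_ker_of_rank_one (hNR : S.NowhereReduced)
    {x : Fin S.m → Vec n} {y : Vec n} (hy : y ≠ 0) (hM : ∀ i, (S.test i).M = vecMulVec (x i) y) :
    ∃ w : Vec n, w ≠ 0 ∧ ∀ i, w ᵥ* (S.test i).M = 0 := by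
  classical
  obtain ⟨q, hq⟩ := Function.ne_iff.mp hy
  obtain ⟨w, hw, horth⟩ := hNR.exists_common_orth_quadPart (Pi.single q 1)
  refine ⟨w, hw, fun i => ?_⟩
  have h1 : x i ⬝ᵥ w = 0 := by
    have h := horth i
    rw [hM i, vecMulVec_mulVec, dotProduct_single, mul_one, op_smul_eq_smul, smul_dotProduct,
      smul_eq_mul] at h
    exact (mul_eq_zero.mp h).resolve_left hq
  rw [hM i, vecMul_vecMulVec, dotProduct_comm, h1, zero_smul]

end AffSystem

end Summit.MatrixMultiplication.MatrixMultiplication.Theorems.GraphEquations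

end
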